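import Summits.HodgeConjecture.HodgeConjecture.Theorems.HeckePrymWeilHyperbolicEightfoldsSqrtMinus7OfStubs
import Summits.HodgeConjecture.HodgeConjecture.Theorems.HeckePrymWeilHyperbolicEightfoldsSqrtMinus7AnchorFibre
import HarnessLib

/-!
# `HyperbolicEightfoldsSqrtMinus7` from a global-class engine, the PEL reach in section form and transport
# (item stmt-HodgeConjecture-14642, route HeckePrymWeil, line `Sketch` = idea `dicyclic-quaternion-switch`, skeleton v5)

The crux `HeckePrymWeil.HyperbolicEightfoldsSqrtMinus7` (Hodge–Weil classes on SPLIT `ℚ(√-7)`-Weil abelian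
eightfolds are algebraic; open in print) REDUCED, kernel-checked, to FOUR statements, all spelled out as
hypotheses (fully hypothetical composition; no named fact is imported as an axiom, no definition, no `sorry`).
This is the v5 sharpening of `hyperbolicEightfoldsSqrtMinus7_of_stubs` (same namespace, file `…OfStubs`, six
hypotheses), by the continuation lead c2 (2026-08-16):

* `hSch : HodgeTheory.Schoen1988_cyclicPrym_weilClasses_algebraic_degreeSix` — Schoen 1988 Cor. 3.1 =
  Patel–Zhang 2025 Thm 5.3 (named fact of the tree), unchanged;
* `hG` — the W-ENGINE on the open total space: every continuous section of the espace étalé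
  `FiberClass f k → S(ℂ)` of an EMBEDDED smooth projective family over a smooth quasi-projective irreducible
  base is the global section of ONE class `W ∈ Hᵏ(𝒳(ℂ); ℂ)`.  Verbatim the hypothesis `hG` of the sibling
  crux's `heckePrymAnchors_of_sections`; it follows from the partie fixe + a Hironaka compactification (the
  landed `stub_globalClassOfSection`, v4's hypotheses `hD`, `hHir`) and, with strictly weaker input, from
  Deligne 1968 / Voisin II Thm 4.18 (`Motives.Voisin2003_invariantCycles`) + the tree's proved Ehresmann local
  triviality and identity principle;
* `hPel` — PEL REACH, v5: the polarized `√-7`-Weil family of the split component through a hyperbolic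
  `(A, φ)` with a CONTINUOUS section `σ` of `FiberClass f 8` through the given class, valued fibrewise in typed
  Weil planes AND of Hodge type `(4,4)` at every point (clause (a) of the proof of [Deligne1982HodgeCycles,
  Thm. 4.8] with [loc. cit., Prop. 4.4]: every fibre is of Weil type `(4,4)` — this replaces v4's hypothesis
  `hCS`, Charles–Schnell 11.3.5 (1)), and an anchor fibre `Y` presented with `φ_Y` and a `φ`-EQUIVARIANT
  ISOGENY PAIR `u : Y ⟶ B`, `v : B ⟶ Y` towards the dicyclic anchor `(B = (ker Φ₆(α_*))⁰, φ₀ = 𝟙 + 2x_B + 2s_B²)`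
  of an étale `Dic₃`-cover datum `(C, 𝒥, α, ξ)` (v4 posited the `ℚ(√-3)`-structure `(ψ_Y, m, t)` of `Y`; it is
  DERIVED here from the landed `stub_dicyclicAlgebra` and the bookkeeping of `…AnchorFibre`);
* `hT` — TRANSPORT (C⁺, OPEN): variational Hodge for typed Weil classes along such a family from a fibre
  `φ`-equivariantly isogenous to the dicyclic anchor (an instance of the route crux `WeilVariationalHodge` at
  `(7,4)`, stmt-HodgeConjecture-14497).

Everything else is PROVED in the tree: `stub_abstractSwitch` (p92596), `stub_switchTransfer` (p90051),
`stub_endAdditiveH1` (p90289), `stub_schoenDicyclic_of_schoen` (p90404), `stub_dicyclicAlgebra` (p96599),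
`stub_exteriorH1`, `transported_*` / `anticomm_bound` (`…AnchorFibre`), `stub_rationalAlongSection` and
`owf_isoTransport` (sibling crux HeckePrymAnchors).

## References
[Schoen1988HodgeWeil] Compositio Math. 65 (1988), Cor. 3.1; [Deligne1982HodgeCycles] LNM 900, Prop. 4.4, Thm. 4.8;
[VoisinHodgeII2003] Thm. 4.18; [vanGeemen1994HodgeAV] LNM 1594, 3.6–3.7, 5.2–5.4.
-/

noncomputable section

-- single-problem summit (Problem = Summit): the mandated namespace repeats `HodgeConjecture`.
set_option linter.dupNamespace false

open CategoryTheory MonoidalCategory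
open Literature.AlgebraicGeometry Literature.AlgebraicGeometry.Motives
  Literature.AlgebraicGeometry.HodgeTheory Literature.AlgebraicTopology.SingularHomology
open Summit.HodgeConjecture.HodgeConjecture.Theorems.HeckePrymWeilLine
  (stub_rationalAlongSection owf_isoTransport)

namespace Summit.HodgeConjecture.HodgeConjecture.Theorems.HyperbolicEightfoldsSqrtMinus7.DicyclicQuaternionSwitch

/-- **The `ℚ(√-3)`-structure of a fibre `φ`-equivariantly isogenous to the dicyclic anchor** (v5 reshape R1 of the
line, packaged): if `(u : Y ⟶ B, v : B ⟶ Y)` is an isogeny pair (`u ≫ v = k = v ≫ u`, `k ≥ 1`) intertwining `φ_Y`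
with `φ_B`, and `B` carries `ψ₀` with `ψ₀² = -3` and `φ_Bψ₀ + ψ₀φ_B = -6` (the dicyclic relations, `stub_dicyclicAlgebra`),
then `Y` carries `ψ_Y` (`:= u ≫ ψ₀ ≫ v`), `m` (`:= k`) and `t` (`:= -6k`) with `ψ_Y² = -3m²`, `φ_Yψ_Y + ψ_Yφ_Y = t`,
`t² < 84m²`, and `(u, v)` is `ℚ(√-3)`-equivariant for `(ψ_Y, m·ψ₀)` — exactly the anchor data skeleton v4 posited and
v5 derives (bookkeeping lemmas `transported_*`, `anticomm_bound` of `…AnchorFibre`). [bookkeeping] -/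
theorem transported_dicyclic_structure :
    ∀ {Y B : AbelianVariety ℂ} (u : Y ⟶ B) (v : B ⟶ Y) (ψ₀ φB : B ⟶ B) (φY : Y ⟶ Y) (k : ℕ),
      0 < k → u ≫ v = (k : ℤ) • 𝟙 Y → v ≫ u = (k : ℤ) • 𝟙 B → u ≫ φB = φY ≫ u → v ≫ φY = φB ≫ v →
      ψ₀ ≫ ψ₀ = (-3 : ℤ) • 𝟙 B → φB ≫ ψ₀ + ψ₀ ≫ φB = (-6 : ℤ) • 𝟙 B →
      ∃ (ψY : Y ⟶ Y) (m : ℕ) (t : ℤ), 0 < m ∧ ψY ≫ ψY = -((3 * (m : ℤ) ^ 2) • 𝟙 Y) ∧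
        φY ≫ ψY + ψY ≫ φY = t • 𝟙 Y ∧ t ^ 2 < 84 * (m : ℤ) ^ 2 ∧
        v ≫ ψY = ((m : ℤ) • ψ₀) ≫ v ∧ u ≫ ((m : ℤ) • ψ₀) = ψY ≫ u := by
  intro Y B u v ψ₀ φB φY k hk huv hvu huφ hvφ hψ₀ hanti₀
  exact ⟨u ≫ ψ₀ ≫ v, k, -6 * (k : ℤ), hk, transported_sq u v ψ₀ k huv hvu hψ₀,
    transported_anticomm u v ψ₀ φB φY k huv huφ hvφ hanti₀, anticomm_bound k hk,
    transported_equivariant_left u v ψ₀ k hvu, transported_equivariant_right u v ψ₀ k hvu⟩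

/-- **REACH with a GLOBAL Weil class, v5: from the W-engine `hG` and the PEL reach in section form `hPel`.**
For a hyperbolic `(A, φ, e, a)` and a non-zero rational `(4,4)` Weil class `c`: an embedded smooth projective
family `f : 𝒳 ⟶ S` of relative dimension `8` over a smooth irreducible quasi-projective base, `e₁ : A.X ≅ 𝒳_{s₁}`,
a GLOBAL class `W ∈ H⁸(𝒳(ℂ); ℂ)` with `e₁^*(W|_{s₁}) = c`, rational of type `(4,4)` on every fibre and lying
fibrewise in typed `√-7`-Weil planes, and the anchor fibre `𝒳_{s₀} ≅ Y` with `φ_Y` and its `φ`-equivariant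
isogeny pair towards the dicyclic `(B, φ₀)`.  PROOF: `hPel` gives the family and the continuous section `σ`
through `c`, of type `(4,4)` everywhere and valued in typed Weil planes; `hG` gives `W` with
`σ = globalSection W`; rationality along `σ` is the tree's PROVED `stub_rationalAlongSection` from the
rationality of `c` at `s₁`; the remaining clauses are read off `σ = globalSection W` (`FiberClass.mk_eq_mk_iff`).
[cite: Deligne1982HodgeCycles, Prop. 4.4 and proof of Thm. 4.8 (a)] [cite: VoisinHodgeII2003, Thm. 4.18] -/
theorem stub_reach_of_sections :
    (∀ ⦃𝒳 S : SchemeOver ℂ⦄ (f : 𝒳 ⟶ S) (n k : ℕ), IsSmoothProjectiveFamily f n →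
      (∃ (N : ℕ) (ι : 𝒳 ⟶ projectiveSpace N ℂ ⊗ S),
          AlgebraicGeometry.IsClosedImmersion ι.left ∧
            ι ≫ CartesianMonoidalCategory.snd (projectiveSpace N ℂ) S = f) →
      AlgebraicGeometry.Smooth S.hom → IsQuasiProjectiveOver S → IrreducibleSpace S.left →
      ∀ (σ : ComplexPoints S → FiberClass f k), Continuous σ → (∀ s, (σ s).pt = s) →
        ∃ W : complexBetti 𝒳 k, ∀ s, σ s = globalSection f k W s) →
    (∀ (A : AbelianVariety ℂ) (φ : A ⟶ A), A.dim = 8 → φ ≫ φ = -((7 : ℤ) • 𝟙 A) →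
      ∀ (e : ProjectiveEmbedding A.X) (a : complexBetti (projectiveSpace e.n ℂ) 2),
        IsRationalClass a → a ≠ 0 →
        IsHyperbolicWeilType A φ 4
          ((7 : ℂ) • complexBetti.map e.ι 2 a + complexBetti.map φ.hom.hom.hom 2 (complexBetti.map e.ι 2 a)) →
      ∀ c : complexBetti A.X 8, c ≠ 0 → IsRationalClass c → IsOfHodgeType 8 A.X 8 4 4 c →
        c ∈ Module.End.eigenspace (complexBetti.map (𝟙 A + φ).hom.hom.hom 8).hom
              ((1 + Complex.I * (Real.sqrt (7 : ℝ) : ℂ)) ^ 8) ⊔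
            Module.End.eigenspace (complexBetti.map (𝟙 A + φ).hom.hom.hom 8).hom
              ((1 - Complex.I * (Real.sqrt (7 : ℝ) : ℂ)) ^ 8) →
      ∃ (𝒳 S : SchemeOver ℂ) (f : 𝒳 ⟶ S) (s₁ s₀ : ComplexPoints S) (e₁ : A.X ≅ fiberOver f s₁)
        (σ : ComplexPoints S → FiberClass f 8),
        IsSmoothProjectiveFamily f 8 ∧
        (∃ (N : ℕ) (ι : 𝒳 ⟶ projectiveSpace N ℂ ⊗ S),
            AlgebraicGeometry.IsClosedImmersion ι.left ∧
              ι ≫ CartesianMonoidalCategory.snd (projectiveSpace N ℂ) S = f) ∧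
        IrreducibleSpace S.left ∧ AlgebraicGeometry.Smooth S.hom ∧ IsQuasiProjectiveOver S ∧
        Continuous σ ∧ (∀ s, (σ s).pt = s) ∧
        σ s₁ = ⟨s₁, complexBetti.map e₁.inv 8 c⟩ ∧
        (∀ s : ComplexPoints S, IsOfHodgeType 8 (fiberOver f (σ s).pt) 8 4 4 (σ s).cls) ∧
        (∀ s : ComplexPoints S, ∃ (x : complexBetti (fiberOver f s) 8) (Ys : AbelianVariety ℂ)
            (ψs : Ys ⟶ Ys) (es : Ys.X ≅ fiberOver f s),
          σ s = ⟨s, x⟩ ∧ Ys.dim = 8 ∧ ψs ≫ ψs = -((7 : ℤ) • 𝟙 Ys) ∧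
          complexBetti.map es.hom 8 x ∈
            Module.End.eigenspace (complexBetti.map (𝟙 Ys + ψs).hom.hom.hom 8).hom
                ((1 + Complex.I * (Real.sqrt (7 : ℝ) : ℂ)) ^ 8) ⊔
              Module.End.eigenspace (complexBetti.map (𝟙 Ys + ψs).hom.hom.hom 8).hom
                ((1 - Complex.I * (Real.sqrt (7 : ℝ) : ℂ)) ^ 8)) ∧
        ∃ (Y : AbelianVariety ℂ) (φY : Y ⟶ Y) (e₀ : Y.X ≅ fiberOver f s₀)
          (x₀ : complexBetti (fiberOver f s₀) 8),
          Y.dim = 8 ∧ φY ≫ φY = -((7 : ℤ) • 𝟙 Y) ∧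
          σ s₀ = ⟨s₀, x₀⟩ ∧
          complexBetti.map e₀.hom 8 x₀ ∈
            Module.End.eigenspace (complexBetti.map (𝟙 Y + φY).hom.hom.hom 8).hom
                ((1 + Complex.I * (Real.sqrt (7 : ℝ) : ℂ)) ^ 8) ⊔
              Module.End.eigenspace (complexBetti.map (𝟙 Y + φY).hom.hom.hom 8).hom
                ((1 - Complex.I * (Real.sqrt (7 : ℝ) : ℂ)) ^ 8) ∧
          ∃ (C : SchemeOver ℂ) (𝒥 : Jacobian C) (α ξ : C ⟶ C) (s x : 𝒥.J ⟶ 𝒥.J)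
            (sB xB ψ₀ φ₀ : AbelianVariety.kerComponent (𝟙 𝒥.J - s + s ≫ s) ⟶
              AbelianVariety.kerComponent (𝟙 𝒥.J - s + s ≫ s))
            (u : Y ⟶ AbelianVariety.kerComponent (𝟙 𝒥.J - s + s ≫ s))
            (v : AbelianVariety.kerComponent (𝟙 𝒥.J - s + s ≫ s) ⟶ Y) (k : ℕ),
            IsSmoothProjective 1 C ∧ 𝒥.J.dim = 25 ∧
            α ≫ α ≫ α ≫ α ≫ α ≫ α = 𝟙 C ∧ ξ ≫ ξ = α ≫ α ≫ α ∧ α ≫ ξ ≫ α = ξ ∧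
            (∀ P : ComplexPoints C, P ≫ (α ≫ α) ≠ P ∧ P ≫ (α ≫ α ≫ α) ≠ P) ∧
            s = 𝒥.pushforward 𝒥 α ∧ x = 𝒥.pushforward 𝒥 ξ ∧
            sB ≫ AbelianVariety.kerComponentι (𝟙 𝒥.J - s + s ≫ s) =
              AbelianVariety.kerComponentι (𝟙 𝒥.J - s + s ≫ s) ≫ s ∧
            xB ≫ AbelianVariety.kerComponentι (𝟙 𝒥.J - s + s ≫ s) =
              AbelianVariety.kerComponentι (𝟙 𝒥.J - s + s ≫ s) ≫ x ∧
            ψ₀ = 𝟙 _ + 2 • (sB ≫ sB) ∧ φ₀ = 𝟙 _ + 2 • xB + 2 • (sB ≫ sB) ∧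
            0 < k ∧ AlgebraicGeometry.Flat u.hom.hom.hom.left ∧
            u ≫ v = (k : ℤ) • 𝟙 Y ∧ v ≫ u = (k : ℤ) • 𝟙 _ ∧ u ≫ φ₀ = φY ≫ u ∧ v ≫ φY = φ₀ ≫ v) →
    ∀ (A : AbelianVariety ℂ) (φ : A ⟶ A), A.dim = 8 → φ ≫ φ = -((7 : ℤ) • 𝟙 A) →
    ∀ (e : ProjectiveEmbedding A.X) (a : complexBetti (projectiveSpace e.n ℂ) 2),
      IsRationalClass a → a ≠ 0 →
      IsHyperbolicWeilType A φ 4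
        ((7 : ℂ) • complexBetti.map e.ι 2 a + complexBetti.map φ.hom.hom.hom 2 (complexBetti.map e.ι 2 a)) →
    ∀ c : complexBetti A.X 8, c ≠ 0 → IsRationalClass c → IsOfHodgeType 8 A.X 8 4 4 c →
      c ∈ Module.End.eigenspace (complexBetti.map (𝟙 A + φ).hom.hom.hom 8).hom
            ((1 + Complex.I * (Real.sqrt (7 : ℝ) : ℂ)) ^ 8) ⊔
          Module.End.eigenspace (complexBetti.map (𝟙 A + φ).hom.hom.hom 8).hom
            ((1 - Complex.I * (Real.sqrt (7 : ℝ) : ℂ)) ^ 8) →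
    ∃ (𝒳 S : SchemeOver ℂ) (f : 𝒳 ⟶ S) (s₁ s₀ : ComplexPoints S) (e₁ : A.X ≅ fiberOver f s₁)
      (W : complexBetti 𝒳 8),
      IsSmoothProjectiveFamily f 8 ∧
      (∃ (N : ℕ) (ι : 𝒳 ⟶ projectiveSpace N ℂ ⊗ S),
          AlgebraicGeometry.IsClosedImmersion ι.left ∧
            ι ≫ CartesianMonoidalCategory.snd (projectiveSpace N ℂ) S = f) ∧
      IrreducibleSpace S.left ∧ AlgebraicGeometry.Smooth S.hom ∧ IsQuasiProjectiveOver S ∧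
      complexBetti.map e₁.hom 8 (complexBetti.map (fiberι f s₁) 8 W) = c ∧
      (∀ s : ComplexPoints S,
        IsRationalClass (complexBetti.map (fiberι f s) 8 W) ∧
        IsOfHodgeType 8 (fiberOver f s) 8 4 4 (complexBetti.map (fiberι f s) 8 W)) ∧
      (∀ s : ComplexPoints S, ∃ (Ys : AbelianVariety ℂ) (ψs : Ys ⟶ Ys) (es : Ys.X ≅ fiberOver f s),
        Ys.dim = 8 ∧ ψs ≫ ψs = -((7 : ℤ) • 𝟙 Ys) ∧
        complexBetti.map es.hom 8 (complexBetti.map (fiberι f s) 8 W) ∈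
          Module.End.eigenspace (complexBetti.map (𝟙 Ys + ψs).hom.hom.hom 8).hom
              ((1 + Complex.I * (Real.sqrt (7 : ℝ) : ℂ)) ^ 8) ⊔
            Module.End.eigenspace (complexBetti.map (𝟙 Ys + ψs).hom.hom.hom 8).hom
              ((1 - Complex.I * (Real.sqrt (7 : ℝ) : ℂ)) ^ 8)) ∧
      ∃ (Y : AbelianVariety ℂ) (φY : Y ⟶ Y) (e₀ : Y.X ≅ fiberOver f s₀),
        Y.dim = 8 ∧ φY ≫ φY = -((7 : ℤ) • 𝟙 Y) ∧
        complexBetti.map e₀.hom 8 (complexBetti.map (fiberι f s₀) 8 W) ∈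
          Module.End.eigenspace (complexBetti.map (𝟙 Y + φY).hom.hom.hom 8).hom
              ((1 + Complex.I * (Real.sqrt (7 : ℝ) : ℂ)) ^ 8) ⊔
            Module.End.eigenspace (complexBetti.map (𝟙 Y + φY).hom.hom.hom 8).hom
              ((1 - Complex.I * (Real.sqrt (7 : ℝ) : ℂ)) ^ 8) ∧
        ∃ (C : SchemeOver ℂ) (𝒥 : Jacobian C) (α ξ : C ⟶ C) (s x : 𝒥.J ⟶ 𝒥.J)
          (sB xB ψ₀ φ₀ : AbelianVariety.kerComponent (𝟙 𝒥.J - s + s ≫ s) ⟶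
            AbelianVariety.kerComponent (𝟙 𝒥.J - s + s ≫ s))
          (u : Y ⟶ AbelianVariety.kerComponent (𝟙 𝒥.J - s + s ≫ s))
          (v : AbelianVariety.kerComponent (𝟙 𝒥.J - s + s ≫ s) ⟶ Y) (k : ℕ),
          IsSmoothProjective 1 C ∧ 𝒥.J.dim = 25 ∧
          α ≫ α ≫ α ≫ α ≫ α ≫ α = 𝟙 C ∧ ξ ≫ ξ = α ≫ α ≫ α ∧ α ≫ ξ ≫ α = ξ ∧
          (∀ P : ComplexPoints C, P ≫ (α ≫ α) ≠ P ∧ P ≫ (α ≫ α ≫ α) ≠ P) ∧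
          s = 𝒥.pushforward 𝒥 α ∧ x = 𝒥.pushforward 𝒥 ξ ∧
          sB ≫ AbelianVariety.kerComponentι (𝟙 𝒥.J - s + s ≫ s) =
            AbelianVariety.kerComponentι (𝟙 𝒥.J - s + s ≫ s) ≫ s ∧
          xB ≫ AbelianVariety.kerComponentι (𝟙 𝒥.J - s + s ≫ s) =
            AbelianVariety.kerComponentι (𝟙 𝒥.J - s + s ≫ s) ≫ x ∧
          ψ₀ = 𝟙 _ + 2 • (sB ≫ sB) ∧ φ₀ = 𝟙 _ + 2 • xB + 2 • (sB ≫ sB) ∧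
          0 < k ∧ AlgebraicGeometry.Flat u.hom.hom.hom.left ∧
          u ≫ v = (k : ℤ) • 𝟙 Y ∧ v ≫ u = (k : ℤ) • 𝟙 _ ∧ u ≫ φ₀ = φY ≫ u ∧ v ≫ φY = φ₀ ≫ v := by
  intro hG hPel A φ hA hφ e a ha ha0 hyp c hc hr hH hW
  obtain ⟨𝒳, S, f, s₁, s₀, e₁, σ, hfam, hι, hirr, hsm, hSqp, hσ, hpt, hs₁, hHodge, hweil, Y, φY, e₀,
    x₀, hY, hφY, hx₀, hplane, hdic⟩ :=
    hPel A φ hA hφ e a ha ha0 hyp c hc hr hH hW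
  -- the global class of the flat section (the W-engine)
  obtain ⟨W, hWσ⟩ := hG f 8 8 hfam hι hsm hSqp hirr σ hσ hpt
  have hcls : ∀ (s : ComplexPoints S) (y : complexBetti (fiberOver f s) 8),
      σ s = ⟨s, y⟩ → complexBetti.map (fiberι f s) 8 W = y := fun s y hy =>
    (FiberClass.mk_eq_mk_iff _ _).1 ((hWσ s).symm.trans hy)
  -- rationality along the section (PROVED in the tree) from the rationality of `c` at `s₁`
  have hrat₁ : IsRationalClass (σ s₁).cls := by
    rw [hs₁]
    exact hr.pullback _
  have hratσ : ∀ s, IsRationalClass (σ s).cls :=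
    stub_rationalAlongSection f 8 8 hfam hsm hSqp hirr σ hσ hpt s₁ hrat₁
  refine ⟨𝒳, S, f, s₁, s₀, e₁, W, hfam, hι, hirr, hsm, hSqp, ?_, ?_, ?_, Y, φY, e₀, hY, hφY, ?_, hdic⟩
  · rw [hcls s₁ _ hs₁]
    exact map_hom_map_inv_apply e₁ 8 c
  · intro s
    have h₁ := hratσ s
    have h₂ := hHodge s
    rw [hWσ s] at h₁ h₂
    exact ⟨h₁, h₂⟩
  · intro s
    obtain ⟨x, Ys, ψs, es, hx, hYs, hψs, hmem⟩ := hweil s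
    refine ⟨Ys, ψs, es, hYs, hψs, ?_⟩
    rw [hcls s x hx]
    exact hmem
  · rw [hcls s₀ x₀ hx₀]
    exact hplane

/-- **`HyperbolicEightfoldsSqrtMinus7` from the line's four open statements (skeleton v5), all as hypotheses**:
`hSch` = Schoen 1988 at degree 6 (named fact), `hG` = the W-engine (global class of a continuous section on the
open total space; Deligne 1968 / partie fixe), `hPel` = the PEL reach in section form with fibrewise Hodge type
and the anchor in isogeny form (moduli construction absent from the tree), `hT` = the transport C⁺ (OPEN; an
instance of `WeilVariationalHodge (7,4)`, stmt-HodgeConjecture-14497).  PROOF: for a rational `(4,4)` Weil class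
`c ≠ 0` of a hyperbolic `(A, φ)`, `stub_reach_of_sections` yields the family, the global class `W` and the
anchor fibre `𝒳_{s₀} ≅ Y` with its `φ`-equivariant isogeny pair `(u, v, k)` towards the dicyclic `(B, φ₀)`;
`stub_dicyclicAlgebra` (`φ₀ψ₀ + ψ₀φ₀ = -6`), `kerComponent_weilOperator_comp_self` (`ψ₀² = -3`) and
`transported_dicyclic_structure` give `ψ_Y := u ≫ ψ₀ ≫ v` with `ψ_Y² = -3k²`, anticommutator `-6k`,
`36k² < 84k²` and `ℚ(√-3)`-equivariance of `(u, v)`; Schoen on the dicyclic datum (`stub_schoenDicyclic_of_schoen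
hSch`, fed with `stub_exteriorH1`, `stub_endAdditiveH1`) makes the typed `ψ_Y`-plane algebraic; the quaternion
field switch (`stub_switchTransfer stub_abstractSwitch …`) gives the typed `φ_Y`-plane, which contains
`e₀^*(W|_{s₀})`; `hT` transports to `s₁`; iso-invariance (`owf_isoTransport`, `mem_algebraicClasses_map_of_iso`)
along `e₀`, `e₁` moves classes between fibres and their presentations; `c = 0` is algebraic trivially.
CONDITIONAL on the four hypotheses; introduces nothing. [cite: Schoen1988HodgeWeil, Corollary 3.1]
[cite: vanGeemen1994HodgeAV, 3.6–3.7 and 5.2–5.4] [cite: Deligne1982HodgeCycles, Prop. 4.4 and proof of Thm. 4.8 (a)]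
[cite: VoisinHodgeII2003, Thm. 4.18] -/
theorem hyperbolicEightfoldsSqrtMinus7_of_sections :
    Schoen1988_cyclicPrym_weilClasses_algebraic_degreeSix →
    (∀ ⦃𝒳 S : SchemeOver ℂ⦄ (f : 𝒳 ⟶ S) (n k : ℕ), IsSmoothProjectiveFamily f n →
      (∃ (N : ℕ) (ι : 𝒳 ⟶ projectiveSpace N ℂ ⊗ S),
          AlgebraicGeometry.IsClosedImmersion ι.left ∧
            ι ≫ CartesianMonoidalCategory.snd (projectiveSpace N ℂ) S = f) →
      AlgebraicGeometry.Smooth S.hom → IsQuasiProjectiveOver S → IrreducibleSpace S.left →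
      ∀ (σ : ComplexPoints S → FiberClass f k), Continuous σ → (∀ s, (σ s).pt = s) →
        ∃ W : complexBetti 𝒳 k, ∀ s, σ s = globalSection f k W s) →
    (∀ (A : AbelianVariety ℂ) (φ : A ⟶ A), A.dim = 8 → φ ≫ φ = -((7 : ℤ) • 𝟙 A) →
      ∀ (e : ProjectiveEmbedding A.X) (a : complexBetti (projectiveSpace e.n ℂ) 2),
        IsRationalClass a → a ≠ 0 →
        IsHyperbolicWeilType A φ 4
          ((7 : ℂ) • complexBetti.map e.ι 2 a + complexBetti.map φ.hom.hom.hom 2 (complexBetti.map e.ι 2 a)) →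
      ∀ c : complexBetti A.X 8, c ≠ 0 → IsRationalClass c → IsOfHodgeType 8 A.X 8 4 4 c →
        c ∈ Module.End.eigenspace (complexBetti.map (𝟙 A + φ).hom.hom.hom 8).hom
              ((1 + Complex.I * (Real.sqrt (7 : ℝ) : ℂ)) ^ 8) ⊔
            Module.End.eigenspace (complexBetti.map (𝟙 A + φ).hom.hom.hom 8).hom
              ((1 - Complex.I * (Real.sqrt (7 : ℝ) : ℂ)) ^ 8) →
      ∃ (𝒳 S : SchemeOver ℂ) (f : 𝒳 ⟶ S) (s₁ s₀ : ComplexPoints S) (e₁ : A.X ≅ fiberOver f s₁)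
        (σ : ComplexPoints S → FiberClass f 8),
        IsSmoothProjectiveFamily f 8 ∧
        (∃ (N : ℕ) (ι : 𝒳 ⟶ projectiveSpace N ℂ ⊗ S),
            AlgebraicGeometry.IsClosedImmersion ι.left ∧
              ι ≫ CartesianMonoidalCategory.snd (projectiveSpace N ℂ) S = f) ∧
        IrreducibleSpace S.left ∧ AlgebraicGeometry.Smooth S.hom ∧ IsQuasiProjectiveOver S ∧
        Continuous σ ∧ (∀ s, (σ s).pt = s) ∧
        σ s₁ = ⟨s₁, complexBetti.map e₁.inv 8 c⟩ ∧
        (∀ s : ComplexPoints S, IsOfHodgeType 8 (fiberOver f (σ s).pt) 8 4 4 (σ s).cls) ∧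
        (∀ s : ComplexPoints S, ∃ (x : complexBetti (fiberOver f s) 8) (Ys : AbelianVariety ℂ)
            (ψs : Ys ⟶ Ys) (es : Ys.X ≅ fiberOver f s),
          σ s = ⟨s, x⟩ ∧ Ys.dim = 8 ∧ ψs ≫ ψs = -((7 : ℤ) • 𝟙 Ys) ∧
          complexBetti.map es.hom 8 x ∈
            Module.End.eigenspace (complexBetti.map (𝟙 Ys + ψs).hom.hom.hom 8).hom
                ((1 + Complex.I * (Real.sqrt (7 : ℝ) : ℂ)) ^ 8) ⊔
              Module.End.eigenspace (complexBetti.map (𝟙 Ys + ψs).hom.hom.hom 8).hom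
                ((1 - Complex.I * (Real.sqrt (7 : ℝ) : ℂ)) ^ 8)) ∧
        ∃ (Y : AbelianVariety ℂ) (φY : Y ⟶ Y) (e₀ : Y.X ≅ fiberOver f s₀)
          (x₀ : complexBetti (fiberOver f s₀) 8),
          Y.dim = 8 ∧ φY ≫ φY = -((7 : ℤ) • 𝟙 Y) ∧
          σ s₀ = ⟨s₀, x₀⟩ ∧
          complexBetti.map e₀.hom 8 x₀ ∈
            Module.End.eigenspace (complexBetti.map (𝟙 Y + φY).hom.hom.hom 8).hom
                ((1 + Complex.I * (Real.sqrt (7 : ℝ) : ℂ)) ^ 8) ⊔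
              Module.End.eigenspace (complexBetti.map (𝟙 Y + φY).hom.hom.hom 8).hom
                ((1 - Complex.I * (Real.sqrt (7 : ℝ) : ℂ)) ^ 8) ∧
          ∃ (C : SchemeOver ℂ) (𝒥 : Jacobian C) (α ξ : C ⟶ C) (s x : 𝒥.J ⟶ 𝒥.J)
            (sB xB ψ₀ φ₀ : AbelianVariety.kerComponent (𝟙 𝒥.J - s + s ≫ s) ⟶
              AbelianVariety.kerComponent (𝟙 𝒥.J - s + s ≫ s))
            (u : Y ⟶ AbelianVariety.kerComponent (𝟙 𝒥.J - s + s ≫ s))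
            (v : AbelianVariety.kerComponent (𝟙 𝒥.J - s + s ≫ s) ⟶ Y) (k : ℕ),
            IsSmoothProjective 1 C ∧ 𝒥.J.dim = 25 ∧
            α ≫ α ≫ α ≫ α ≫ α ≫ α = 𝟙 C ∧ ξ ≫ ξ = α ≫ α ≫ α ∧ α ≫ ξ ≫ α = ξ ∧
            (∀ P : ComplexPoints C, P ≫ (α ≫ α) ≠ P ∧ P ≫ (α ≫ α ≫ α) ≠ P) ∧
            s = 𝒥.pushforward 𝒥 α ∧ x = 𝒥.pushforward 𝒥 ξ ∧
            sB ≫ AbelianVariety.kerComponentι (𝟙 𝒥.J - s + s ≫ s) =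
              AbelianVariety.kerComponentι (𝟙 𝒥.J - s + s ≫ s) ≫ s ∧
            xB ≫ AbelianVariety.kerComponentι (𝟙 𝒥.J - s + s ≫ s) =
              AbelianVariety.kerComponentι (𝟙 𝒥.J - s + s ≫ s) ≫ x ∧
            ψ₀ = 𝟙 _ + 2 • (sB ≫ sB) ∧ φ₀ = 𝟙 _ + 2 • xB + 2 • (sB ≫ sB) ∧
            0 < k ∧ AlgebraicGeometry.Flat u.hom.hom.hom.left ∧
            u ≫ v = (k : ℤ) • 𝟙 Y ∧ v ≫ u = (k : ℤ) • 𝟙 _ ∧ u ≫ φ₀ = φY ≫ u ∧ v ≫ φY = φ₀ ≫ v) →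
    (∀ ⦃𝒳 S : SchemeOver ℂ⦄ (f : 𝒳 ⟶ S), IsSmoothProjectiveFamily f 8 →
        (∃ (N : ℕ) (ι : 𝒳 ⟶ projectiveSpace N ℂ ⊗ S),
            AlgebraicGeometry.IsClosedImmersion ι.left ∧
              ι ≫ CartesianMonoidalCategory.snd (projectiveSpace N ℂ) S = f) →
        IrreducibleSpace S.left → AlgebraicGeometry.Smooth S.hom → IsQuasiProjectiveOver S →
      ∀ (W : complexBetti 𝒳 8),
        (∀ s : ComplexPoints S,
          IsRationalClass (complexBetti.map (fiberι f s) 8 W) ∧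
          IsOfHodgeType 8 (fiberOver f s) 8 4 4 (complexBetti.map (fiberι f s) 8 W)) →
        (∀ s : ComplexPoints S, ∃ (Ys : AbelianVariety ℂ) (ψs : Ys ⟶ Ys) (es : Ys.X ≅ fiberOver f s),
          Ys.dim = 8 ∧ ψs ≫ ψs = -((7 : ℤ) • 𝟙 Ys) ∧
          complexBetti.map es.hom 8 (complexBetti.map (fiberι f s) 8 W) ∈
            Module.End.eigenspace (complexBetti.map (𝟙 Ys + ψs).hom.hom.hom 8).hom
                ((1 + Complex.I * (Real.sqrt (7 : ℝ) : ℂ)) ^ 8) ⊔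
              Module.End.eigenspace (complexBetti.map (𝟙 Ys + ψs).hom.hom.hom 8).hom
                ((1 - Complex.I * (Real.sqrt (7 : ℝ) : ℂ)) ^ 8)) →
      ∀ s₀ : ComplexPoints S,
        (∃ (Y : AbelianVariety ℂ) (φY : Y ⟶ Y) (e₀ : Y.X ≅ fiberOver f s₀),
          Y.dim = 8 ∧ φY ≫ φY = -((7 : ℤ) • 𝟙 Y) ∧
          complexBetti.map e₀.hom 8 (complexBetti.map (fiberι f s₀) 8 W) ∈
            Module.End.eigenspace (complexBetti.map (𝟙 Y + φY).hom.hom.hom 8).hom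
                ((1 + Complex.I * (Real.sqrt (7 : ℝ) : ℂ)) ^ 8) ⊔
              Module.End.eigenspace (complexBetti.map (𝟙 Y + φY).hom.hom.hom 8).hom
                ((1 - Complex.I * (Real.sqrt (7 : ℝ) : ℂ)) ^ 8) ∧
          ∃ (C : SchemeOver ℂ) (𝒥 : Jacobian C) (α ξ : C ⟶ C) (s x : 𝒥.J ⟶ 𝒥.J)
            (sB xB ψ₀ φ₀ : AbelianVariety.kerComponent (𝟙 𝒥.J - s + s ≫ s) ⟶
              AbelianVariety.kerComponent (𝟙 𝒥.J - s + s ≫ s))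
            (u : Y ⟶ AbelianVariety.kerComponent (𝟙 𝒥.J - s + s ≫ s))
            (v : AbelianVariety.kerComponent (𝟙 𝒥.J - s + s ≫ s) ⟶ Y) (k : ℕ),
            IsSmoothProjective 1 C ∧ 𝒥.J.dim = 25 ∧
            α ≫ α ≫ α ≫ α ≫ α ≫ α = 𝟙 C ∧ ξ ≫ ξ = α ≫ α ≫ α ∧ α ≫ ξ ≫ α = ξ ∧
            (∀ P : ComplexPoints C, P ≫ (α ≫ α) ≠ P ∧ P ≫ (α ≫ α ≫ α) ≠ P) ∧
            s = 𝒥.pushforward 𝒥 α ∧ x = 𝒥.pushforward 𝒥 ξ ∧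
            sB ≫ AbelianVariety.kerComponentι (𝟙 𝒥.J - s + s ≫ s) =
              AbelianVariety.kerComponentι (𝟙 𝒥.J - s + s ≫ s) ≫ s ∧
            xB ≫ AbelianVariety.kerComponentι (𝟙 𝒥.J - s + s ≫ s) =
              AbelianVariety.kerComponentι (𝟙 𝒥.J - s + s ≫ s) ≫ x ∧
            ψ₀ = 𝟙 _ + 2 • (sB ≫ sB) ∧ φ₀ = 𝟙 _ + 2 • xB + 2 • (sB ≫ sB) ∧
            0 < k ∧ AlgebraicGeometry.Flat u.hom.hom.hom.left ∧
            u ≫ v = (k : ℤ) • 𝟙 Y ∧ v ≫ u = (k : ℤ) • 𝟙 _ ∧ u ≫ φ₀ = φY ≫ u ∧ v ≫ φY = φ₀ ≫ v) →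
        complexBetti.map (fiberι f s₀) 8 W ∈ algebraicClasses (fiberOver f s₀) 4 →
      ∀ s : ComplexPoints S, complexBetti.map (fiberι f s) 8 W ∈ algebraicClasses (fiberOver f s) 4) →
    Summit.HodgeConjecture.HodgeConjecture.Theses.HeckePrymWeil.HyperbolicEightfoldsSqrtMinus7 := by
  intro hSch hG hPel hT A φ hA hφ e a ha ha0 hyp c hr hH hW
  by_cases hc : c = 0
  · rw [hc]
    exact Submodule.zero_mem _
  obtain ⟨𝒳, S, f, s₁, s₀, e₁, W, hf, hι, hirr, hsm, hSqp, hWc, hall, hweil, Y, φY, e₀, hY, hφY, hplane,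
    C, 𝒥, α, ξ, s, x, sB, xB, ψ₀, φ₀, u, v, k, hC, hg25, hα6, hξ2, hrel, hfree, hs, hx, hsB, hxB, hψ₀, hφ₀,
    hk, hflat, huv, hvu, huφ, hvφ⟩ :=
    stub_reach_of_sections hG hPel A φ hA hφ e a ha ha0 hyp c hc hr hH hW
  -- the definite quaternion algebra at the anchor (landed algebra): `φ₀ψ₀ + ψ₀φ₀ = -6`, `ψ₀² = -3`
  obtain ⟨-, hanti₀⟩ := stub_dicyclicAlgebra C 𝒥 α ξ hα6 hξ2 hrel s x hs hx sB xB ψ₀ φ₀ hsB hxB hψ₀ hφ₀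
  have hψ₀sq : ψ₀ ≫ ψ₀ = (-3 : ℤ) • 𝟙 _ := kerComponent_weilOperator_comp_self hsB hψ₀
  -- the transported `ℚ(√-3)`-structure on `Y`: `ψ_Y`, `m`, `t` and the equivariance of `(u, v)`
  obtain ⟨ψY, m, t, hm, hψY, hanti, ht, hvψ, huψ⟩ :=
    transported_dicyclic_structure u v ψ₀ φ₀ φY k hk huv hvu huφ hvφ hψ₀sq hanti₀
  -- Schoen on the dicyclic datum + isogeny invariance: the typed `ψ_Y`-plane of `Y` is algebraic
  have hψalg := stub_schoenDicyclic_of_schoen hSch stub_exteriorH1 stub_endAdditiveH1 C 𝒥 α ξ hC hg25 hα6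
    hξ2 hrel hfree s x hs hx sB xB ψ₀ hsB hxB hψ₀ Y ψY m k u v hm hk hflat huv hvψ huψ
  -- the switch: the typed `φ_Y`-plane of `Y` is algebraic
  have hφalg := stub_switchTransfer stub_abstractSwitch stub_exteriorH1 stub_endAdditiveH1 Y φY ψY m t hY hm hφY
    hψY hanti ht hψalg
  -- at the anchor fibre
  have h0 : complexBetti.map (fiberι f s₀) 8 W ∈ algebraicClasses (fiberOver f s₀) 4 :=
    owf_isoTransport _ Y e₀ 4 _ (hφalg _ hplane)
  -- transport to `s₁` (the anchor hypothesis of `hT` is the isogeny datum of `Y`)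
  have h1 : complexBetti.map (fiberι f s₁) 8 W ∈ algebraicClasses (fiberOver f s₁) 4 :=
    hT f hf hι hirr hsm hSqp W hall hweil s₀
      ⟨Y, φY, e₀, hY, hφY, hplane, C, 𝒥, α, ξ, s, x, sB, xB, ψ₀, φ₀, u, v, k, hC, hg25, hα6, hξ2, hrel,
        hfree, hs, hx, hsB, hxB, hψ₀, hφ₀, hk, hflat, huv, hvu, huφ, hvφ⟩ h0 s₁
  -- along `e₁ : A ≅ 𝒳_{s₁}`
  have key := mem_algebraicClasses_map_of_iso (p := 4) (hf.isSmoothProjective s₁)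
    (AbelianVariety.isSmoothProjective_holds (A := A)) e₁ h1
  rw [hWc] at key
  exact key

end Summit.HodgeConjecture.HodgeConjecture.Theorems.HyperbolicEightfoldsSqrtMinus7.DicyclicQuaternionSwitch

end
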